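import Literature.NumberTheory.EllipticCurves.Kato2004.IwasawaH1LayerEigenfunctionalTwistZetaTwoPairLawProofs
import Literature.NumberTheory.EllipticCurves.Kato2004.ZetaBodyTwistPairValuesTwoNegTwoProofs
import Literature.NumberTheory.EllipticCurves.Kato2004.IwasawaCohomologyTwistLiftTwoLevelThree
import Literature.NumberTheory.EllipticCurves.Kato2004.ZetaLineRankOneRigidityFinsetProofs
import Literature.NumberTheory.EllipticCurves.Kato2004.EulerSystemValuesNegTwoTwistPair
import Literature.NumberTheory.EllipticCurves.Kato2004.EulerSystemBoundFineSelmerTwo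
import Summits.BirchSwinnertonDyer.BirchSwinnertonDyer.Theorems.CyclotomicUntwistRohrlichAtLevel
import HarnessLib

/-!
# Route ByReductionTypeAtTwo, crux `AdditiveRankZeroAtTwo` (stmt-BirchSwinnertonDyer-19098), child C4″
# (stmt-BirchSwinnertonDyer-22618) — reading step T22 (b) of the descent sockets on the (−2)-SPLIT-TWIST block (T22 (e)), ODD-BRANCH
# SIDE: the transported zeta line `Λ·ỹ` (`ỹ` = the odd-branch transport of Kato's family of `f_{W″}`, `W″ = W^{(−2)}`) and Kato's line
# `Λ·y` of `f_W` AGREE at every height-one prime `𝔮 ∌ 2` of `Λ` — a THEOREM modulo ONE construction fact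
# (`Kato2004.exists_eulerSystem_expStar_values_negTwoTwistPair_two`) and Kato Thm. 12.4 (2) (`Kato2004.thm12_4`); Rohrlich fed from the kernel

Cell `bsd-2adic` (run/shared/lean/pub/bsd-2adic/), seat `bsd-2adic-addL2x` GEN 22 (repair-census entry R-B85 (2), the (−2)-twin of
`…AdditiveKatoOddBranchEigenfunctionalsAtTwo.lean`, GEN 21 p748597). The socket `AddKatoTwo.KatoDescentSocketAtTwoAdditiveNegTwoSplitTwist`
(30 X5@2 classes with irreducible `E[2]`; module docstring of `…AdditiveKatoDescentSocketDefs.lean`, T22 (e): «the (−2)-block … (a)–(d) word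
for word») needs, in step T22 (b), «`Z̃` and Kato's `Z(f_W)` agree at every height-one `𝔮 ∌ 2`» for the transported class of `f″ = f_{W″}`.
The difference with the (−1)-block is purely in the levels: the twist identification `u : T₂W″ ≃ T₂W` is equivariant on
`Gal(ℚ̄/ℚ(√−2))`, `√−2 = ζ₈ + ζ₈³ ∈ ℚ(μ_8) ∖ ℚ(μ_4)`, so the coefficient change `u_*` exists on the levels `ℚ(μ_{2^k·∏ℓ})` with `k ≥ 3`
only, the transported class is pinned by its layer components `proj_n ỹ = Cor_{ℚ(μ_{2^{n+2}})/ℚ_n}(u_* z″_{n+2,∅})` for `n ≥ 1`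
(`Kato2004.IwasawaH1Data.existsUnique_twistLift_of_zetaBody_two_three`, p749563), the twist element is `s_m` with `ι_m(s_m) = √2·I`
(`Kato2004.exists_embed_eq_sqrt_two_mul_I`), the odd twist character is `χ₈′ = (−2/·)` (`a_n(f″) = χ₈′(n)a_n(f_W)` for odd `n`,
`Kato2004.isDepletedTwistedL_twist_negTwo_of`) and the pair value law is `Kato2004.embed_twistSum_mul_eq_embed_sum_mul_negTwo` (p749870:
`C_W·ι(ξ″) = C_{W″}·ι(ξ)`, `C_W = κ[a/A]⁻_f/Ω⁺_f`, `C_{W″} = −√2·κ″[a″/A]⁺_{f″}/Ω⁻_{f″}`, Kato's pair datum with `8 ∣ A` so that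
`χ₈′(c) = χ₈′(d) = 1`, `Kato2004.exists_katoPairDatum_dvd`); the assembly is the GENERIC `Kato2004.exists_finsets_forall_layerEigenfunctional_twistLift_two_of_pairLaw`
(threshold `k₀ = 3`, `sd = √2·I`), the rigidity `Kato2004.IwasawaH1Data.lengthAt_quotient_span_eq_of_layerFunctionals_finset` (GEN 21 p747070),
`Kato2004.zetaBody_lift_ne_zero_of_rohrlich_two`, and Rohrlich's finiteness the KERNEL theorem `PSRohrlichAtLevel.rohrlich_primePow_of_isNewformOf`:

* `AddKatoTwo.lengthAt_quotient_twistLift_negTwo_eq_of_zetaBodyPair` — the UNIVERSAL form: for ANY two `ZetaBody` witnesses of `W` and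
  `W″ = W^{(−2)}` over ONE pair datum (`c ≡ d ≡ 1 (mod 8)`), linked through `u` on the levels `k ≥ 3`, the lifts `y` (all layers) and `ỹ`
  (layers `n ≥ 1`) satisfy `ℓ_𝔮(𝐇¹/Λỹ) = ℓ_𝔮(𝐇¹/Λy)` at every prime `𝔮 ∌ 2` of `Λ`, GRANTED `Kato2004.thm12_4`;
* `AddKatoTwo.exists_oddBranchLine_eq_kato_line_negTwo` — GRANTED `Kato2004.exists_eulerSystem_expStar_values_negTwoTwistPair_two` and
  `Kato2004.thm12_4`, for `W[2]` irreducible: there are a genuine `2`-adic Euler-system class `y ≠ 0` (`Kato2004.IsEulerSystemClassTwo`) and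
  a class `ỹ ≠ 0` which IS the odd-branch transport of an Euler system for `T₂W″` along a `u : T₂W″ ≃ T₂W` equivariant on the levels
  `k ≥ 3` (`proj_n ỹ = Cor u_* z″_{n+2,∅}` for every `n ≥ 1`), with `ℓ_𝔮(𝐇¹_Γ(T₂W)/Λỹ) = ℓ_𝔮(𝐇¹_Γ(T₂W)/Λy)` at every prime `𝔮 ∌ 2`.

WHAT REMAINS A READING in T22 on the (−2)-block after this file (named precisely): (b) — NOTHING beyond the ONE construction fact and
Thm. 12.4 (2) (the identification of the socket package's abstract `Z` with `Λ·ỹ` belongs to reading (a), as on the (−1)-block); (a) —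
unchanged; the member (reducible `E[2]`, 9 classes) twin needs a member-pair fact. HONEST FRAMING (D-0036/D-0054): theorems only,
conditional on the named facts (hypotheses BY NAME, never asserted); closes nothing; nothing booked; the sockets stay `@[conjecture]`
(MEMO tier); BSD is not proved by any of this.

References: [Kato2004Asterisque] Thm. 12.4 (2), Thm. 12.5 (1)(2) (pp. 221–222), Thm. 12.6 (p. 222), 12.1 (pp. 219–220), §13.8 (p. 228),
13.5 (2) (p. 227), Thm. 9.7, Thm. 6.6 (1); [RohrlichInventiones1984]; [SilvermanAEC2009] X.5 Cor. 5.4, Ex. 10.16; [Rubin2000] Ch. VI;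
[MazurTateTeitelbaum1986Invent] §I.12–I.14; [Washington1997] §7.1, §13.1; memo run/shared/lean/pub/bsd-2adic/addL2x/VERDICT-19098-addL2x-GEN22.md.
-/

set_option autoImplicit false
-- the summit's namespace `Summit.BirchSwinnertonDyer.BirchSwinnertonDyer` (Sub = Summit) trips `dupNamespace`
set_option linter.dupNamespace false

noncomputable section

open scoped NumberField TensorProduct

namespace Summit.BirchSwinnertonDyer.BirchSwinnertonDyer.Theorems.AddKatoTwo

open Field CongruenceSubgroup WeierstrassCurve IsDedekindDomain Literature.NumberTheory.GaloisRepresentations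
  Literature.NumberTheory.EllipticCurves Literature.NumberTheory.EllipticCurves.ModularForms
  Literature.NumberTheory.EllipticCurves.Kato2004 Literature.NumberTheory.EllipticCurves.Kato2004.EulerSystemValues

variable {W : WeierstrassCurve ℚ} [W.IsElliptic] [ContinuousSMul ℤ_[2] (W.tateModule 2)]
  [Module.Free ℤ_[2] (W.tateModule 2)] [Module.Finite ℤ_[2] (W.tateModule 2)]
  [(W.quadraticTwist (-2)).IsElliptic] [ContinuousSMul ℤ_[2] ((W.quadraticTwist (-2)).tateModule 2)]
  [Module.Free ℤ_[2] ((W.quadraticTwist (-2)).tateModule 2)] [Module.Finite ℤ_[2] ((W.quadraticTwist (-2)).tateModule 2)]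
  {κ : ZpExtension ℚ 2} {γ : absoluteGaloisGroup ℚ} (I : Kato2004.IwasawaH1Data W 2 κ γ)

/-- `8 ∣ 2^{n+2} = cycLevel 2 (n+2) ∅` when `3 ≤ n + 2`. [folklore] -/
private theorem eight_dvd_cycLevel_of_le {n : ℕ} (hn : 3 ≤ n + 2) : 8 ∣ cycLevel 2 (n + 2) ∅ := by
  have hM : cycLevel 2 (n + 2) ∅ = 2 ^ (n + 2) := by simp [cycLevel]
  rw [hM]
  obtain ⟨m, rfl⟩ : ∃ m, n = m + 1 := ⟨n - 1, by omega⟩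
  rw [show m + 1 + 2 = 3 + m by ring, pow_add]
  exact Dvd.intro _ rfl

/-- **T22 (b) on the (−2)-block, universal form: for ANY linked pair of `ZetaBody` witnesses of `W` and `W″ = W^{(−2)}` the transported line and
Kato's line agree away from `2`.** Data: `W/ℚ` elliptic, newforms `f` of `W`, `f″` of `W″`; `ZetaBody W 2 f ι κ₀ Λ c d a A z x` and
`ZetaBody W″ 2 f″ ι κ₀″ Λ″ c d a″ A z″ x″` over ONE pair datum (`(c,12A) = (d,12N) = (d,12N″) = 1`, `c ≡ d ≡ 1 (mod A)` and `(mod 8)`, `c, d > 1`,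
`[a/A]⁻_f ≠ 0`, `[a″/A]⁺_{f″} ≠ 0`); `u : T₂W″ ≃ T₂W` continuous, equivariant on the levels `k ≥ 3` and LINKED: `Λ(u_* y₁) = (1 ⊗ s_m)Λ″(y₁)` for
THE `s_m` with `ι_m(s_m) = √2·I`; `κ` cyclotomic with topological generator `γ`; a pin `I`; `y` with `proj_n y = Cor z_{n+2,∅}` (all `n`) and `ỹ`
with `proj_n ỹ = Cor u_* z″_{n+2,∅}` for `n ≥ 1`. Then, GRANTED `Kato2004.thm12_4`, `ℓ_𝔮(𝐇¹/Λỹ) = ℓ_𝔮(𝐇¹/Λy)` at every prime `𝔮 ∌ 2` of `Λ`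
(Rohrlich from the kernel; `y ≠ 0`; the pair value law `embed_twistSum_mul_eq_embed_sum_mul_negTwo`; the generic eigenfunctional assembly
with `k₀ = 3`, `sd = √2·I`; the finite-ratio rigidity). [cite: Kato2004Asterisque, Thm. 12.4 (2), Thm. 12.5 (1)(2) (pp. 221–222), 13.5 (2) (p. 227), Thm. 12.6 (p. 222)]
[cite: RohrlichInventiones1984, Theorem (p. 409)] -/
theorem lengthAt_quotient_twistLift_negTwo_eq_of_zetaBodyPair (h12 : Kato2004.thm12_4) (hκ : κ.IsCyclotomic)
    (hγ : κ.IsTopGenerator γ)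
    {N N' : ℕ} [NeZero N] [NeZero N'] {f : CuspForm (Gamma0 N) 2} {f' : CuspForm (Gamma0 N') 2}
    {ι : (m : ℕ) → (CyclotomicField m ℚ →+* ℂ)} {κ₀ κ₀' : ℝ}
    {Λ : ∀ (k : ℕ) (r : Finset (HeightOneSpectrum (𝓞 ℚ))),
      H1 (tateRep W 2) (cycSubgroup 2 k r) →ₗ[ℤ_[2]] ℚ_[2] ⊗[ℚ] CyclotomicField (cycLevel 2 k r) ℚ}
    {Λ' : ∀ (k : ℕ) (r : Finset (HeightOneSpectrum (𝓞 ℚ))),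
      H1 (tateRep (W.quadraticTwist (-2)) 2) (cycSubgroup 2 k r) →ₗ[ℤ_[2]] ℚ_[2] ⊗[ℚ] CyclotomicField (cycLevel 2 k r) ℚ}
    {c d a a' : ℤ} {A : ℕ}
    {z : ∀ (k : ℕ) (r : (cyclotomicLevelsRat 2 (badPlaces c d A N)).Ideals),
      H1 (tateRep W 2) ((cyclotomicLevelsRat 2 (badPlaces c d A N)).level k r.1)}
    {x : ∀ (k : ℕ) (r : (cyclotomicLevelsRat 2 (badPlaces c d A N)).Ideals), CyclotomicField (cycLevel 2 k r.1) ℚ}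
    {z' : ∀ (k : ℕ) (r : (cyclotomicLevelsRat 2 (badPlaces c d A N')).Ideals),
      H1 (tateRep (W.quadraticTwist (-2)) 2) ((cyclotomicLevelsRat 2 (badPlaces c d A N')).level k r.1)}
    {x' : ∀ (k : ℕ) (r : (cyclotomicLevelsRat 2 (badPlaces c d A N')).Ideals), CyclotomicField (cycLevel 2 k r.1) ℚ}
    (hbody : ZetaBody W 2 f ι κ₀ Λ c d a A z x) (hbody' : ZetaBody (W.quadraticTwist (-2)) 2 f' ι κ₀' Λ' c d a' A z' x')
    (hf : IsNewformOf W f) (hf' : IsNewformOf (W.quadraticTwist (-2)) f') (hκ₀ : κ₀ ≠ 0) (hκ₀' : κ₀' ≠ 0) (hA : 0 < A)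
    (hc : Int.gcd c (6 * 2 * A) = 1) (hd : Int.gcd d (6 * 2 * N) = 1) (hd' : Int.gcd d (6 * 2 * N') = 1)
    (hcA : (A : ℤ) ∣ c - 1) (hdA : (A : ℤ) ∣ d - 1) (hc8 : (8 : ℤ) ∣ c - 1) (hd8 : (8 : ℤ) ∣ d - 1) (hc1 : 1 < c) (hd1 : 1 < d)
    (ha : ratMinusSymbol f ((a : ℚ) / A) ≠ 0) (ha' : ratPlusSymbol f' ((a' : ℚ) / A) ≠ 0)
    (u : (W.quadraticTwist (-2)).tateModule 2 ≃ₗ[ℤ_[2]] W.tateModule 2) (hu : Continuous u)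
    (hV : ∀ k : ℕ, 3 ≤ k → ∀ (r : Finset (HeightOneSpectrum (𝓞 ℚ))) (σ : absoluteGaloisGroup ℚ),
      σ ∈ cycSubgroup 2 k r → ∀ t : (W.quadraticTwist (-2)).tateModule 2, u (σ • t) = σ • u t)
    (hlink : ∀ (k : ℕ) (hk : 3 ≤ k) (r : Finset (HeightOneSpectrum (𝓞 ℚ))) (s : CyclotomicField (cycLevel 2 k r) ℚ),
      ι (cycLevel 2 k r) s = ((Real.sqrt 2 : ℝ) : ℂ) * Complex.I →
      ∀ y₁ : H1 (tateRep (W.quadraticTwist (-2)) 2) (cycSubgroup 2 k r),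
        Λ k r (twistH1On W (W.quadraticTwist (-2)) u hu (hV k hk r) y₁) = ((1 : ℚ_[2]) ⊗ₜ[ℚ] s) * Λ' k r y₁)
    {y : I.H} (hy : ∀ n : ℕ, I.proj n y = levelToLayerTwo W hκ (badPlaces c d A N) n
      (z (n + 2) (cyclotomicLevelsRat 2 (badPlaces c d A N)).idealOne))
    {y' : I.H} (hy' : ∀ (n : ℕ) (hn : 1 ≤ n), I.proj n y' = levelToLayerTwo W hκ (badPlaces c d A N') n
      (twistH1On W (W.quadraticTwist (-2)) u hu
        (equivariant_level_of_cycSubgroup_three W (W.quadraticTwist (-2)) u hV (badPlaces c d A N') n hn)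
        (z' (n + 2) (cyclotomicLevelsRat 2 (badPlaces c d A N')).idealOne)))
    (𝔮 : PrimeSpectrum (IwasawaAlgebra 2)) (hp𝔮 : PowerSeries.C (2 : ℤ_[2]) ∉ 𝔮.asIdeal) :
    Module.lengthAt (IwasawaAlgebra 2) (I.H ⧸ Submodule.span (IwasawaAlgebra 2) {y'}) 𝔮 =
      Module.lengthAt (IwasawaAlgebra 2) (I.H ⧸ Submodule.span (IwasawaAlgebra 2) {y}) 𝔮 := by
  have hR := PSRohrlichAtLevel.rohrlich_primePow_of_isNewformOf (p := 2) hf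
  have hy0 : y ≠ 0 := Kato2004.zetaBody_lift_ne_zero_of_rohrlich_two hbody hf hκ₀ hA hc hd hcA hdA hc1 hd1 ha hκ hy hR
  -- the two constants of the pair value law
  have hΩ : (plusPeriod f : ℂ) ≠ 0 := by exact_mod_cast (IsNewform0.plusPeriod_pos_holds hf.1 hf.coeffField_eq_bot).ne'
  have hΩ' : (minusPeriod f' : ℂ) ≠ 0 := by exact_mod_cast (IsNewform0.minusPeriod_pos_holds hf'.1 hf'.coeffField_eq_bot).ne'
  have hsqrt : ((Real.sqrt 2 : ℝ) : ℂ) ≠ 0 := by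
    exact_mod_cast (Real.sqrt_pos.mpr (by norm_num : (0 : ℝ) < 2)).ne'
  have hCW0 : (κ₀ : ℂ) * ((ratMinusSymbol f ((a : ℚ) / A) : ℚ) : ℂ) / (plusPeriod f : ℂ) ≠ 0 :=
    div_ne_zero (mul_ne_zero (by exact_mod_cast hκ₀) (by exact_mod_cast ha)) hΩ
  have hCT0 : -((((Real.sqrt 2 : ℝ) : ℂ)) * (κ₀' : ℂ)) * ((ratPlusSymbol f' ((a' : ℚ) / A) : ℚ) : ℂ) / (minusPeriod f' : ℂ) ≠ 0 :=
    div_ne_zero (mul_ne_zero (neg_ne_zero.mpr (mul_ne_zero hsqrt (by exact_mod_cast hκ₀'))) (by exact_mod_cast ha')) hΩ'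
  obtain ⟨S, P, hP, hw⟩ := Kato2004.exists_finsets_forall_layerEigenfunctional_twistLift_two_of_pairLaw (I := I) u hu hV
    hbody hbody' hf hκ₀ hA hc hd hcA hdA hc1 hd1 ha (((Real.sqrt 2 : ℝ) : ℂ) * Complex.I) _ _ hCW0 hCT0
    (fun n hn ↦ Kato2004.exists_embed_eq_sqrt_two_mul_I (ι (cycLevel 2 (n + 2) ∅)) (eight_dvd_cycLevel_of_le hn))
    (fun n hn s hs ψ hψ xT hxT ↦ Kato2004.embed_twistSum_mul_eq_embed_sum_mul_negTwo hbody hbody' hf hf' hA hc hd hd' hcA hdA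
      hc8 hd8 n (by omega) hs ψ hψ xT hxT)
    hlink hκ hγ hy (fun n hn ↦ hy' n (by omega)) hR
  exact Kato2004.IwasawaH1Data.lengthAt_quotient_span_eq_of_layerFunctionals_finset I h12 hκ hγ hy0 P hP S
    (fun m hm χ hχp hχe _ hS ↦ hw m hm χ hχp hχe hS) 𝔮 hp𝔮

/-- **T22 (b) on the (−2)-block at `p = 2` from the ONE construction fact, `W[2]` irreducible: the odd-branch transported zeta line of
`f_{W″}` and Kato's zeta line of `f_W` agree at every prime `𝔮 ∌ 2` of `Λ`.** For `W/ℚ` elliptic with `W[2]` irreducible, newforms `f` of `W`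
and `f″` of `W″ = W^{(−2)}`, `κ` cyclotomic with topological generator `γ`, any pin `I`: GRANTED
`Kato2004.exists_eulerSystem_expStar_values_negTwoTwistPair_two` and `Kato2004.thm12_4`, there are `y, ỹ ∈ 𝐇¹_Γ(T₂W)` — `y` a genuine `2`-adic
Euler-system class (`Kato2004.IsEulerSystemClassTwo`) `≠ 0` (the lift of Kato's family of `f_W`), `ỹ ≠ 0` THE ODD-BRANCH TRANSPORT of an Euler
system `z″` for `T₂W″` (Kato's family of `f″`) along a continuous `ℤ₂`-identification `u : T₂W″ ≃ T₂W` equivariant on every level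
`Gal(ℚ̄/ℚ(μ_{2^k·∏ℓ}))`, `k ≥ 3`: `proj_n ỹ = Cor_{ℚ(μ_{2^{n+2}})/ℚ_n}(u_* z″_{n+2,∅})` for every `n ≥ 1` (the layer `0` component is forced by the
trace) — with `ℓ_𝔮(𝐇¹_Γ(T₂W)/Λỹ) = ℓ_𝔮(𝐇¹_Γ(T₂W)/Λy)` at every prime `𝔮 ∌ 2` of `Λ`. This is the socket's T22 (b) on the (−2)-block («`Z̃` and
`Z(f_W)` agree at every height-one `𝔮 ∌ 2`», T22 (e)) for `Z̃ = Λỹ`, `Z = Λy`; Rohrlich is the kernel theorem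
`PSRohrlichAtLevel.rohrlich_primePow_of_isNewformOf`. [cite: Kato2004Asterisque, Thm. 12.4 (2), Thm. 12.5 (1)(2) (pp. 221–222), Thm. 12.6 (p. 222), 12.1 (pp. 219–220), 13.5 (2) (p. 227)]
[cite: SilvermanAEC2009, X.5 Cor. 5.4] [cite: Rubin2000, Ch. VI] -/
theorem exists_oddBranchLine_eq_kato_line_negTwo (hκ : κ.IsCyclotomic) (hγ : κ.IsTopGenerator γ)
    (hPair : Kato2004.exists_eulerSystem_expStar_values_negTwoTwistPair_two) (h12 : Kato2004.thm12_4)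
    (hirr : W.HasIrreducibleModPGaloisRep 2) {N : ℕ} [NeZero N] (f : CuspForm (Gamma0 N) 2) (hf : IsNewformOf W f)
    {N' : ℕ} [NeZero N'] (f' : CuspForm (Gamma0 N') 2) (hf' : IsNewformOf (W.quadraticTwist (-2)) f') :
    ∃ y y' : I.H, Kato2004.IsEulerSystemClassTwo W hκ I y ∧ y ≠ 0 ∧ y' ≠ 0 ∧
      (∃ (u : (W.quadraticTwist (-2)).tateModule 2 ≃ₗ[ℤ_[2]] W.tateModule 2) (hu : Continuous u)
        (hV : ∀ k : ℕ, 3 ≤ k → ∀ (r : Finset (HeightOneSpectrum (𝓞 ℚ))) (σ : absoluteGaloisGroup ℚ),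
          σ ∈ cycSubgroup 2 k r → ∀ t : (W.quadraticTwist (-2)).tateModule 2, u (σ • t) = σ • u t)
        (S : Set (HeightOneSpectrum (𝓞 ℚ)))
        (z' : ∀ (k : ℕ) (r : (cyclotomicLevelsRat 2 S).Ideals),
          H1 (tateRep (W.quadraticTwist (-2)) 2) ((cyclotomicLevelsRat 2 S).level k r.1)),
        IsEulerSystem (cyclotomicLevelsRat 2 S) (tateRep (W.quadraticTwist (-2)) 2) 2 z' ∧
        ∀ (n : ℕ) (hn : 1 ≤ n), I.proj n y' = levelToLayerTwo W hκ S n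
          (twistH1On W (W.quadraticTwist (-2)) u hu
            (equivariant_level_of_cycSubgroup_three W (W.quadraticTwist (-2)) u hV S n hn)
            (z' (n + 2) (cyclotomicLevelsRat 2 S).idealOne))) ∧
      ∀ (𝔮 : PrimeSpectrum (IwasawaAlgebra 2)), PowerSeries.C (2 : ℤ_[2]) ∉ 𝔮.asIdeal →
        Module.lengthAt (IwasawaAlgebra 2) (I.H ⧸ Submodule.span (IwasawaAlgebra 2) {y'}) 𝔮 =
          Module.lengthAt (IwasawaAlgebra 2) (I.H ⧸ Submodule.span (IwasawaAlgebra 2) {y}) 𝔮 := by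
  set ι : (m : ℕ) → (CyclotomicField m ℚ →+* ℂ) :=
    fun m ↦ Classical.choice (inferInstance : Nonempty (CyclotomicField m ℚ →+* ℂ)) with hι
  obtain ⟨u, hu, hV, κ₀, hκ₀, κ₀', hκ₀', Λ, Λ', hlink, hfamW, hfamT⟩ := hPair W hirr f hf f' hf' ι
  obtain ⟨c, d, a, a', A, hA, hc, hd, hd', hcA, hdA, hc8, hd8, hc1, hd1, ha, ha'⟩ :=
    Kato2004.exists_katoPairDatum_dvd f hf.1 hf.coeffField_eq_bot f' hf'.1 hf'.coeffField_eq_bot 2 8 (by norm_num)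
  obtain ⟨z, x, hbody⟩ := hfamW c d a A hA hc hd
  obtain ⟨z', x', hbody'⟩ := hfamT c d a' A hA hc hd'
  have hne := Kato2004.two_mul_natAbs_ne_zero_of_guards 2 hA (NeZero.ne N) hc hd
  obtain ⟨y, hyES, hy⟩ := Kato2004.exists_isEulerSystemClassTwo_of_zetaBody W hκ I f ι κ₀ Λ c d a A z x hbody hne
  obtain ⟨y', hy', -⟩ := Kato2004.IwasawaH1Data.existsUnique_twistLift_of_zetaBody_two_three W (W.quadraticTwist (-2)) u hu hκ I hV
    f' ι κ₀' Λ' c d a' A z' x' hbody'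
  have hR := PSRohrlichAtLevel.rohrlich_primePow_of_isNewformOf (p := 2) hf
  have hy0 : y ≠ 0 := Kato2004.zetaBody_lift_ne_zero_of_rohrlich_two hbody hf hκ₀ hA hc hd hcA hdA hc1 hd1 ha hκ hy hR
  have hc8' : (8 : ℤ) ∣ c - 1 := by exact_mod_cast hc8
  have hd8' : (8 : ℤ) ∣ d - 1 := by exact_mod_cast hd8
  have hlen : ∀ (𝔮 : PrimeSpectrum (IwasawaAlgebra 2)), PowerSeries.C (2 : ℤ_[2]) ∉ 𝔮.asIdeal →
      Module.lengthAt (IwasawaAlgebra 2) (I.H ⧸ Submodule.span (IwasawaAlgebra 2) {y'}) 𝔮 =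
        Module.lengthAt (IwasawaAlgebra 2) (I.H ⧸ Submodule.span (IwasawaAlgebra 2) {y}) 𝔮 := fun 𝔮 hp𝔮 ↦
    lengthAt_quotient_twistLift_negTwo_eq_of_zetaBodyPair I h12 hκ hγ hbody hbody' hf hf' hκ₀ hκ₀' hA hc hd hd' hcA hdA hc8' hd8'
      hc1 hd1 ha ha' u hu hV hlink hy hy' 𝔮 hp𝔮
  -- `ỹ ≠ 0`: some layer value `w(proj_n ỹ) = ρ · w(proj_n y)` with `ρ ≠ 0`, `w(proj_n y) ≠ 0`
  have hΩ : (plusPeriod f : ℂ) ≠ 0 := by exact_mod_cast (IsNewform0.plusPeriod_pos_holds hf.1 hf.coeffField_eq_bot).ne'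
  have hΩ' : (minusPeriod f' : ℂ) ≠ 0 := by exact_mod_cast (IsNewform0.minusPeriod_pos_holds hf'.1 hf'.coeffField_eq_bot).ne'
  have hsqrt : ((Real.sqrt 2 : ℝ) : ℂ) ≠ 0 := by
    exact_mod_cast (Real.sqrt_pos.mpr (by norm_num : (0 : ℝ) < 2)).ne'
  have hCW0 : (κ₀ : ℂ) * ((ratMinusSymbol f ((a : ℚ) / A) : ℚ) : ℂ) / (plusPeriod f : ℂ) ≠ 0 :=
    div_ne_zero (mul_ne_zero (by exact_mod_cast hκ₀) (by exact_mod_cast ha)) hΩ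
  have hCT0 : -((((Real.sqrt 2 : ℝ) : ℂ)) * (κ₀' : ℂ)) * ((ratPlusSymbol f' ((a' : ℚ) / A) : ℚ) : ℂ) / (minusPeriod f' : ℂ) ≠ 0 :=
    div_ne_zero (mul_ne_zero (neg_ne_zero.mpr (mul_ne_zero hsqrt (by exact_mod_cast hκ₀'))) (by exact_mod_cast ha')) hΩ'
  obtain ⟨S, P, hP, hw⟩ := Kato2004.exists_finsets_forall_layerEigenfunctional_twistLift_two_of_pairLaw (I := I) u hu hV
    hbody hbody' hf hκ₀ hA hc hd hcA hdA hc1 hd1 ha (((Real.sqrt 2 : ℝ) : ℂ) * Complex.I) _ _ hCW0 hCT0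
    (fun n hn ↦ Kato2004.exists_embed_eq_sqrt_two_mul_I (ι (cycLevel 2 (n + 2) ∅)) (eight_dvd_cycLevel_of_le hn))
    (fun n hn s hs ψ hψ xT hxT ↦ Kato2004.embed_twistSum_mul_eq_embed_sum_mul_negTwo hbody hbody' hf hf' hA hc hd hd' hcA hdA
      hc8' hd8' n (by omega) hs ψ hψ xT hxT)
    hlink hκ hγ hy (fun n hn ↦ hy' n (by omega)) hR
  have hy'0 : y' ≠ 0 := by
    intro h0
    -- every character point `ζ − 1` (`ζ` of exact `2`-power order) would lie in the finite set `S`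
    have key : ∀ j : ℕ, ∃ t ∈ S, ∃ ζ : ℂ_[2], IsPrimitiveRoot ζ (2 ^ (j + 1)) ∧ t = ζ - 1 := by
      intro j
      obtain ⟨ζ, hζ⟩ := HasEnoughRootsOfUnity.exists_primitiveRoot ℂ_[2] (2 ^ (j + 1))
      obtain ⟨χ, hχp, hχe, -, hχγ⟩ := exists_character_apply_cyclotomicGenerator_eq (p := 2) j hζ
      by_cases hS : (χ (cyclotomicGenerator 2 : ZMod (2 ^ (j + 1 + cyclotomicExponent 2))) - 1) ∈ S
      · exact ⟨_, hS, ζ, hζ, by rw [hχγ]⟩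
      · exfalso
        obtain ⟨n, w, -, -, -, hwz, ρ, hρP, hprop⟩ := hw (j + 1 + cyclotomicExponent 2) (by omega) χ hχp hχe hS
        have hρ0 : ρ ≠ 0 := fun h ↦ hP (h ▸ hρP)
        have hzero : ρ * w (I.proj n y) = 0 := by rw [← hprop, h0, map_zero, map_zero]
        exact hwz ((mul_eq_zero.mp hzero).resolve_left hρ0)
    choose t ht ζ hζ htζ using key
    have hinj : Function.Injective t := by
      intro j₁ j₂ h
      have h' : ζ j₁ = ζ j₂ := by
        have e₁ := htζ j₁
        have e₂ := htζ j₂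
        have : ζ j₁ - 1 = ζ j₂ - 1 := by rw [← e₁, ← e₂, h]
        exact sub_left_injective this
      have hpow : 2 ^ (j₁ + 1) = 2 ^ (j₂ + 1) := by rw [(hζ j₁).eq_orderOf, (hζ j₂).eq_orderOf, h']
      have := Nat.pow_right_injective (le_refl 2) hpow
      omega
    exact Set.infinite_range_of_injective hinj (S.finite_toSet.subset (by rintro _ ⟨j, rfl⟩; exact ht j))
  exact ⟨y, y', hyES, hy0, hy'0, ⟨u, hu, hV, badPlaces c d A N', z', hbody'.1, hy'⟩, hlen⟩

end Summit.BirchSwinnertonDyer.BirchSwinnertonDyer.Theorems.AddKatoTwo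

end
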